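import Summits.QuantumFields.YangMills.Theorems.PoincareLipschitzOrbitMinimiserLevel
import Summits.QuantumFields.YangMills.Theorems.PoincareLipschitzOrbitMinimiserLinearCoulomb
import HarnessLib

/-!
# Crux stmt-QuantumFields-19936 `UnitScaleTilt.HistoryTailL`, K2 at depth (route crux `PoincareLipschitz.BlockLipschitzL`, stmt-QuantumFields-23533):
# F2b — THE COULOMB ∕ SCALAR ∕ KIRCHHOFF ∕ LINEARISED-COULOMB LETTERS OF A BOX-ℓ²-ORBIT MINIMISER AT EVERY LEVEL `i`

Verbatim level-`i` twins of the level-zero letters ✓p681590 §3 (`re_trace_su_mul_siteSum_eq_zero_of_orbitMin`), ✓p682271 §3 (`siteSum_eq_smul_one_of_orbitMin`),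
✓p682908 (`kirchhoff_of_orbitMin`) and ✓p683497 (`norm_covDiv_le_of_orbitMin`), for pairs `(V, V')` of level-`i` `SU(2)` fields (`GaugeField P i`) and level-`i`
gauge transformations (`GaugeTransf P i`), over F2's level-`i` one-site competitor ✓`PoincareLipschitzOrbitMinLevel.reTr_oneSite_le_of_orbitMin_level` (p683212);
the `M₂(ℂ)` letters (✓`re_trace_mul_eq_zero_of_forall_le`, `reTr_eq_half_re_trace`, the quaternionic letters, `coe_inv_eq_conjTranspose`,
`norm_exp_sub_exp_neg_sub_two_smul_le`, `norm_conj_le`) are level-free and imported.  For the per-level re-minimisation of the supplier's induction (K2 supplier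
plan of record, card v1.27, row F6); the averages FROM level `i` are orbit functions of the level-`i` field by ✓`dist1_plaqHol_iterFrom_gaugeAct`.

WHAT THIS IS NOT: nothing here proves h⋆, `stub_iteratedLipschitz`, the crux `BlockLipschitzL`, the crux `HistoryTailL`, rung R3 (YM₃ on T³ — not d = 4,
not infinite volume, not a mass gap, not the Clay problem) or a summit statement.  Width seat ym-ust-19936-w5 g10 (cell ym3-torus),
`--supports stmt-QuantumFields-19936`.
-/

noncomputable section

open scoped BigOperators Matrix.Norms.L2Operator Matrix ComplexOrder

namespace Summit.QuantumFields.YangMills.Theorems.PoincareLipschitzOrbitMinLevelCoulomb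

open Literature.MathematicalPhysics.QuantumFieldTheory.Balaban1983to89
open NormedSpace
open Summit.QuantumFields.YangMills.Theorems.PoincareLipschitzOrbitMinCoulomb (re_trace_mul_eq_zero_of_forall_le reTr_eq_half_re_trace)
open Summit.QuantumFields.YangMills.Theorems.PoincareLipschitzOrbitMinScalar (quat_add quat_sum_ite quat_coe_su2 eq_smul_one_of_quat_of_forall_re_trace)
open Summit.QuantumFields.YangMills.Theorems.PoincareLipschitzOrbitMinKirchhoff (coe_inv_eq_conjTranspose)
open Summit.QuantumFields.YangMills.Theorems.PoincareLipschitzOrbitMinLinearCoulomb (norm_exp_sub_exp_neg_sub_two_smul_le norm_conj_le)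
open Summit.QuantumFields.YangMills.Theorems.PoincareLipschitzOrbitMinLevel (reTr_oneSite_le_of_orbitMin_level)

variable {P : Params} {i : ℕ}

/-! ## §1 Covariant Coulomb at level `i` -/

/-- ★★ **THE U-COULOMB CONDITION OF A LEVEL-`i` BOX-ℓ²-ORBIT MINIMISER** (verbatim twin of ✓`re_trace_su_mul_siteSum_eq_zero_of_orbitMin`).  If `U'` is a box-`ℓ²`-closest point of its level-zero gauge orbit to `U`, then at
every site `x` and for every `X ∈ 𝔰𝔲(2)` (skew-Hermitian, trace-free)
`Re tr( X · [ Σ_{b∈box, b₋=x} U'_bU_b⁻¹ + Σ_{b∈box, b₊=x} U'_b⁻¹U_b ] ) = 0`: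
the `𝔰𝔲(2)`-part of the covariant lattice divergence at `x` of the perturbation `W_b = U'_bU_b⁻¹` vanishes (§1 + §2).
[cite: Balaban1985Averaging, (156)–(163) p.42 (the regime this opens); Balaban1987RG1, (0.14) p.254] -/
theorem re_trace_su_mul_siteSum_eq_zero_of_orbitMin_level (box : PBond P i → Prop) [DecidablePred box]
    (U U' : GaugeField P i (Matrix.specialUnitaryGroup (Fin 2) ℂ))
    (hmin : ∀ k : GaugeTransf P i (Matrix.specialUnitaryGroup (Fin 2) ℂ),
      (∑ b : PBond P i, if box b then dist1 (U b * (U' b)⁻¹) ^ 2 else 0) ≤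
        ∑ b : PBond P i, if box b then dist1 (U b * (GaugeField.gaugeAct k U' b)⁻¹) ^ 2 else 0)
    (x : Site P i) {X : Matrix (Fin 2) (Fin 2) ℂ} (hX : X ∈ skewAdjoint (Matrix (Fin 2) (Fin 2) ℂ)) (htr : X.trace = 0) :
    ((X * ((∑ b : PBond P i, if box b ∧ b.src = x then (((U' b : Matrix.specialUnitaryGroup (Fin 2) ℂ) : Matrix (Fin 2) (Fin 2) ℂ) * (((U b)⁻¹ : Matrix.specialUnitaryGroup (Fin 2) ℂ) : Matrix (Fin 2) (Fin 2) ℂ)) else 0) +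
        (∑ b : PBond P i, if box b ∧ b.tgt = x then ((((U' b)⁻¹ : Matrix.specialUnitaryGroup (Fin 2) ℂ) : Matrix (Fin 2) (Fin 2) ℂ) * ((U b : Matrix.specialUnitaryGroup (Fin 2) ℂ) : Matrix (Fin 2) (Fin 2) ℂ)) else 0))).trace).re = 0 := by
  set M : Matrix (Fin 2) (Fin 2) ℂ :=
    (∑ b : PBond P i, if box b ∧ b.src = x then (((U' b : Matrix.specialUnitaryGroup (Fin 2) ℂ) : Matrix (Fin 2) (Fin 2) ℂ) * (((U b)⁻¹ : Matrix.specialUnitaryGroup (Fin 2) ℂ) : Matrix (Fin 2) (Fin 2) ℂ)) else 0) +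
      (∑ b : PBond P i, if box b ∧ b.tgt = x then ((((U' b)⁻¹ : Matrix.specialUnitaryGroup (Fin 2) ℂ) : Matrix (Fin 2) (Fin 2) ℂ) * ((U b : Matrix.specialUnitaryGroup (Fin 2) ℂ) : Matrix (Fin 2) (Fin 2) ℂ)) else 0) with hM
  refine re_trace_mul_eq_zero_of_forall_le M X (fun g => ?_) hX htr
  -- `Re tr(A·M)` distributes over the two site sums
  have hdist : ∀ A : Matrix (Fin 2) (Fin 2) ℂ, ((A * M).trace).re =
      (∑ b : PBond P i, if box b ∧ b.src = x then ((A * (((U' b : Matrix.specialUnitaryGroup (Fin 2) ℂ) : Matrix (Fin 2) (Fin 2) ℂ) * (((U b)⁻¹ : Matrix.specialUnitaryGroup (Fin 2) ℂ) : Matrix (Fin 2) (Fin 2) ℂ))).trace).re else 0) +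
        (∑ b : PBond P i, if box b ∧ b.tgt = x then ((A * ((((U' b)⁻¹ : Matrix.specialUnitaryGroup (Fin 2) ℂ) : Matrix (Fin 2) (Fin 2) ℂ) * ((U b : Matrix.specialUnitaryGroup (Fin 2) ℂ) : Matrix (Fin 2) (Fin 2) ℂ))).trace).re else 0) := by
    intro A
    rw [hM, mul_add, Finset.mul_sum, Finset.mul_sum, Matrix.trace_add, Matrix.trace_sum, Matrix.trace_sum, Complex.add_re,
      Complex.re_sum, Complex.re_sum]
    congr 1
    · refine Finset.sum_congr rfl fun b _ => ?_
      split_ifs <;> simp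
    · refine Finset.sum_congr rfl fun b _ => ?_
      split_ifs <;> simp
  -- the group letters of §1, read in matrices
  have hg := reTr_oneSite_le_of_orbitMin_level box U U' hmin x g
  simp only [reTr_eq_half_re_trace, Submonoid.coe_mul] at hg
  rw [hdist, show (M.trace).re = ((1 * M).trace).re by rw [one_mul], hdist 1]
  simp only [one_mul]
  have h2 : ∀ (c : PBond P i → Prop) [DecidablePred c] (f : PBond P i → ℝ),
      (∑ b : PBond P i, if c b then f b / 2 else 0) = (∑ b : PBond P i, if c b then f b else 0) / 2 := by
    intro c _ f
    rw [Finset.sum_div]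
    exact Finset.sum_congr rfl fun b _ => by split_ifs <;> simp
  rw [h2, h2, h2, h2] at hg
  linarith


/-! ## §2 Scalar form at level `i` -/

/-- ★★ **AT A LEVEL-`i` BOX-ℓ²-ORBIT MINIMISER EVERY SITE MATRIX IS A NON-NEGATIVE REAL SCALAR** (twin of ✓`siteSum_eq_smul_one_of_orbitMin`).  If `U'` is a box-`ℓ²`-closest point of its level-zero gauge
orbit to `U` (`∀ k, Σ_box dist1(U_b U'_b⁻¹)² ≤ Σ_box dist1(U_b((U'^k)_b)⁻¹)²`), then for every site `x` the matrix
`M_x = Σ_{b∈box, b₋=x} U'_bU_b⁻¹ + Σ_{b∈box, b₊=x} U'_b⁻¹U_b` equals `(Re tr M_x / 2)·1` with `Re tr M_x ≥ 0`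
(§2 on ✓`re_trace_su_mul_siteSum_eq_zero_of_orbitMin`; the sign from the competitor `g = −1` of ✓`reTr_oneSite_le_of_orbitMin`).
[cite: Balaban1987RG1, (0.14) p.254; Balaban1985Averaging, (156)–(163) p.42 (the regime this opens)] -/
theorem siteSum_eq_smul_one_of_orbitMin_level (box : PBond P i → Prop) [DecidablePred box]
    (U U' : GaugeField P i (Matrix.specialUnitaryGroup (Fin 2) ℂ))
    (hmin : ∀ k : GaugeTransf P i (Matrix.specialUnitaryGroup (Fin 2) ℂ),
      (∑ b : PBond P i, if box b then dist1 (U b * (U' b)⁻¹) ^ 2 else 0) ≤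
        ∑ b : PBond P i, if box b then dist1 (U b * (GaugeField.gaugeAct k U' b)⁻¹) ^ 2 else 0)
    (x : Site P i) :
    ((∑ b : PBond P i, if box b ∧ b.src = x then (((U' b : Matrix.specialUnitaryGroup (Fin 2) ℂ) : Matrix (Fin 2) (Fin 2) ℂ) * (((U b)⁻¹ : Matrix.specialUnitaryGroup (Fin 2) ℂ) : Matrix (Fin 2) (Fin 2) ℂ)) else 0) +
        (∑ b : PBond P i, if box b ∧ b.tgt = x then ((((U' b)⁻¹ : Matrix.specialUnitaryGroup (Fin 2) ℂ) : Matrix (Fin 2) (Fin 2) ℂ) * ((U b : Matrix.specialUnitaryGroup (Fin 2) ℂ) : Matrix (Fin 2) (Fin 2) ℂ)) else 0)) =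
      (((((∑ b : PBond P i, if box b ∧ b.src = x then (((U' b : Matrix.specialUnitaryGroup (Fin 2) ℂ) : Matrix (Fin 2) (Fin 2) ℂ) * (((U b)⁻¹ : Matrix.specialUnitaryGroup (Fin 2) ℂ) : Matrix (Fin 2) (Fin 2) ℂ)) else 0) +
        (∑ b : PBond P i, if box b ∧ b.tgt = x then ((((U' b)⁻¹ : Matrix.specialUnitaryGroup (Fin 2) ℂ) : Matrix (Fin 2) (Fin 2) ℂ) * ((U b : Matrix.specialUnitaryGroup (Fin 2) ℂ) : Matrix (Fin 2) (Fin 2) ℂ)) else 0)).trace).re / 2 : ℝ) : ℂ) • (1 : Matrix (Fin 2) (Fin 2) ℂ) ∧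
    0 ≤ (((∑ b : PBond P i, if box b ∧ b.src = x then (((U' b : Matrix.specialUnitaryGroup (Fin 2) ℂ) : Matrix (Fin 2) (Fin 2) ℂ) * (((U b)⁻¹ : Matrix.specialUnitaryGroup (Fin 2) ℂ) : Matrix (Fin 2) (Fin 2) ℂ)) else 0) +
        (∑ b : PBond P i, if box b ∧ b.tgt = x then ((((U' b)⁻¹ : Matrix.specialUnitaryGroup (Fin 2) ℂ) : Matrix (Fin 2) (Fin 2) ℂ) * ((U b : Matrix.specialUnitaryGroup (Fin 2) ℂ) : Matrix (Fin 2) (Fin 2) ℂ)) else 0)).trace).re := by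
  refine ⟨?_, ?_⟩
  · -- `M_x ∈ ℍ`, then §2 with the Coulomb letter
    refine eq_smul_one_of_quat_of_forall_re_trace ?_ (fun X hX htr => re_trace_su_mul_siteSum_eq_zero_of_orbitMin_level box U U' hmin x hX htr)
    refine quat_add ?_ ?_
    · refine quat_sum_ite _ _ _ fun b _ _ => ?_
      rw [← Submonoid.coe_mul]
      exact quat_coe_su2 _
    · refine quat_sum_ite _ _ _ fun b _ _ => ?_
      rw [← Submonoid.coe_mul]
      exact quat_coe_su2 _
  · -- the competitor `g = −1`
    have hneg : (-1 : Matrix (Fin 2) (Fin 2) ℂ) ∈ Matrix.specialUnitaryGroup (Fin 2) ℂ := by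
      rw [Matrix.mem_specialUnitaryGroup_iff]
      refine ⟨?_, ?_⟩
      · rw [Matrix.mem_unitaryGroup_iff]
        simp
      · rw [Matrix.det_neg, Matrix.det_one, Fintype.card_fin]
        norm_num
    have hg := reTr_oneSite_le_of_orbitMin_level box U U' hmin x ⟨-1, hneg⟩
    simp only [reTr_eq_half_re_trace, Submonoid.coe_mul, neg_one_mul, Matrix.trace_neg, Complex.neg_re] at hg
    rw [Matrix.trace_add, Matrix.trace_sum, Matrix.trace_sum, Complex.add_re, Complex.re_sum, Complex.re_sum]
    have h1 : ∀ (c : PBond P i → Prop) [DecidablePred c] (f : PBond P i → Matrix (Fin 2) (Fin 2) ℂ),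
        (∑ b : PBond P i, ((if c b then f b else 0).trace).re) = ∑ b : PBond P i, if c b then ((f b).trace).re else 0 := by
      intro c _ f
      exact Finset.sum_congr rfl fun b _ => by split_ifs <;> simp
    have h2 : ∀ (c : PBond P i → Prop) [DecidablePred c] (f : PBond P i → ℝ),
        (∑ b : PBond P i, if c b then f b / 2 else 0) = (∑ b : PBond P i, if c b then f b else 0) / 2 := by
      intro c _ f
      rw [Finset.sum_div]
      exact Finset.sum_congr rfl fun b _ => by split_ifs <;> simp
    have h3 : ∀ (c : PBond P i → Prop) [DecidablePred c] (f : PBond P i → ℝ),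
        (∑ b : PBond P i, if c b then -f b / 2 else 0) = -((∑ b : PBond P i, if c b then f b else 0) / 2) := by
      intro c _ f
      rw [Finset.sum_div, ← Finset.sum_neg_distrib]
      exact Finset.sum_congr rfl fun b _ => by split_ifs <;> simp [neg_div]
    rw [h1, h1]
    rw [h3, h3, h2, h2] at hg
    linarith


/-! ## §3 Kirchhoff form at level `i` -/

/-- ★★ **KIRCHHOFF'S LAW AT A LEVEL-`i` BOX-ℓ²-ORBIT MINIMISER** (twin of ✓`kirchhoff_of_orbitMin`).  If `U'` is a box-`ℓ²`-closest point of its level-zero gauge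
orbit to `U` (`∀ k, Σ_box dist1(U_b U'_b⁻¹)² ≤ Σ_box dist1(U_b((U'^k)_b)⁻¹)²`), then at every site `x`
`Σ_{b∈box, b₋=x} (U'_bU_b⁻¹ − U_bU'_b⁻¹) = Σ_{b∈box, b₊=x} (U_b⁻¹U'_b − U'_b⁻¹U_b)`, i.e. `Σ_out J_b = Σ_in U_b⁻¹J_bU_b` for the current
`J_b = W_b − W_b⁻¹`, `W_b = U'_bU_b⁻¹` (`M_x = M_xᴴ` from ✓`siteSum_eq_smul_one_of_orbitMin`, `Vᴴ = V⁻¹`). [cite: Balaban1985Averaging, (156)–(163) p.42 (the regime this opens)] -/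
theorem kirchhoff_of_orbitMin_level (box : PBond P i → Prop) [DecidablePred box]
    (U U' : GaugeField P i (Matrix.specialUnitaryGroup (Fin 2) ℂ))
    (hmin : ∀ k : GaugeTransf P i (Matrix.specialUnitaryGroup (Fin 2) ℂ),
      (∑ b : PBond P i, if box b then dist1 (U b * (U' b)⁻¹) ^ 2 else 0) ≤
        ∑ b : PBond P i, if box b then dist1 (U b * (GaugeField.gaugeAct k U' b)⁻¹) ^ 2 else 0)
    (x : Site P i) :
    (∑ b : PBond P i, if box b ∧ b.src = x then
        ((((U' b : Matrix.specialUnitaryGroup (Fin 2) ℂ) : Matrix (Fin 2) (Fin 2) ℂ) * (((U b)⁻¹ : Matrix.specialUnitaryGroup (Fin 2) ℂ) : Matrix (Fin 2) (Fin 2) ℂ)) -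
          (((U b : Matrix.specialUnitaryGroup (Fin 2) ℂ) : Matrix (Fin 2) (Fin 2) ℂ) * (((U' b)⁻¹ : Matrix.specialUnitaryGroup (Fin 2) ℂ) : Matrix (Fin 2) (Fin 2) ℂ))) else 0) =
      ∑ b : PBond P i, if box b ∧ b.tgt = x then
        (((((U b)⁻¹ : Matrix.specialUnitaryGroup (Fin 2) ℂ) : Matrix (Fin 2) (Fin 2) ℂ) * ((U' b : Matrix.specialUnitaryGroup (Fin 2) ℂ) : Matrix (Fin 2) (Fin 2) ℂ)) -
          ((((U' b)⁻¹ : Matrix.specialUnitaryGroup (Fin 2) ℂ) : Matrix (Fin 2) (Fin 2) ℂ) * ((U b : Matrix.specialUnitaryGroup (Fin 2) ℂ) : Matrix (Fin 2) (Fin 2) ℂ))) else 0 := by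
  -- abbreviations for the four bond matrices
  set A : PBond P i → Matrix (Fin 2) (Fin 2) ℂ := fun b =>
    ((U' b : Matrix.specialUnitaryGroup (Fin 2) ℂ) : Matrix (Fin 2) (Fin 2) ℂ) * (((U b)⁻¹ : Matrix.specialUnitaryGroup (Fin 2) ℂ) : Matrix (Fin 2) (Fin 2) ℂ) with hA
  set A' : PBond P i → Matrix (Fin 2) (Fin 2) ℂ := fun b =>
    ((U b : Matrix.specialUnitaryGroup (Fin 2) ℂ) : Matrix (Fin 2) (Fin 2) ℂ) * (((U' b)⁻¹ : Matrix.specialUnitaryGroup (Fin 2) ℂ) : Matrix (Fin 2) (Fin 2) ℂ) with hA'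
  set B : PBond P i → Matrix (Fin 2) (Fin 2) ℂ := fun b =>
    (((U' b)⁻¹ : Matrix.specialUnitaryGroup (Fin 2) ℂ) : Matrix (Fin 2) (Fin 2) ℂ) * ((U b : Matrix.specialUnitaryGroup (Fin 2) ℂ) : Matrix (Fin 2) (Fin 2) ℂ) with hB
  set B' : PBond P i → Matrix (Fin 2) (Fin 2) ℂ := fun b =>
    (((U b)⁻¹ : Matrix.specialUnitaryGroup (Fin 2) ℂ) : Matrix (Fin 2) (Fin 2) ℂ) * ((U' b : Matrix.specialUnitaryGroup (Fin 2) ℂ) : Matrix (Fin 2) (Fin 2) ℂ) with hB'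
  -- conjugate transposes of the bond matrices (`Vᴴ = V⁻¹`, `(V⁻¹)ᴴ = V`)
  have hct : ∀ V : Matrix.specialUnitaryGroup (Fin 2) ℂ, ((V : Matrix (Fin 2) (Fin 2) ℂ))ᴴ = (((V⁻¹ : Matrix.specialUnitaryGroup (Fin 2) ℂ)) : Matrix (Fin 2) (Fin 2) ℂ) :=
    fun V => (coe_inv_eq_conjTranspose V).symm
  have hcti : ∀ V : Matrix.specialUnitaryGroup (Fin 2) ℂ, ((((V⁻¹ : Matrix.specialUnitaryGroup (Fin 2) ℂ)) : Matrix (Fin 2) (Fin 2) ℂ))ᴴ = (V : Matrix (Fin 2) (Fin 2) ℂ) :=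
    fun V => by rw [coe_inv_eq_conjTranspose, Matrix.conjTranspose_conjTranspose]
  have hAH : ∀ b, (A b)ᴴ = A' b := fun b => by
    simp only [hA, hA', Matrix.conjTranspose_mul, hcti, hct]
  have hBH : ∀ b, (B b)ᴴ = B' b := fun b => by
    simp only [hB, hB', Matrix.conjTranspose_mul, hcti, hct]
  -- the scalar identity of the minimiser and its Hermitian symmetry
  obtain ⟨hM, -⟩ := siteSum_eq_smul_one_of_orbitMin_level box U U' hmin x
  have hsym : ((∑ b : PBond P i, if box b ∧ b.src = x then A b else 0) + ∑ b : PBond P i, if box b ∧ b.tgt = x then B b else 0)ᴴ =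
      (∑ b : PBond P i, if box b ∧ b.src = x then A b else 0) + ∑ b : PBond P i, if box b ∧ b.tgt = x then B b else 0 := by
    have hM' : (∑ b : PBond P i, if box b ∧ b.src = x then A b else 0) + (∑ b : PBond P i, if box b ∧ b.tgt = x then B b else 0) =
        (((((∑ b : PBond P i, if box b ∧ b.src = x then A b else 0) + ∑ b : PBond P i, if box b ∧ b.tgt = x then B b else 0).trace).re / 2 : ℝ) : ℂ) •
          (1 : Matrix (Fin 2) (Fin 2) ℂ) := hM
    set r : ℝ := ((((∑ b : PBond P i, if box b ∧ b.src = x then A b else 0) + ∑ b : PBond P i, if box b ∧ b.tgt = x then B b else 0).trace).re / 2) with hr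
    rw [hM', Matrix.conjTranspose_smul, Matrix.conjTranspose_one, Complex.star_def, Complex.conj_ofReal]
  -- expand the conjugate transpose of the guarded sums
  have hexp : ((∑ b : PBond P i, if box b ∧ b.src = x then A b else 0) + ∑ b : PBond P i, if box b ∧ b.tgt = x then B b else 0)ᴴ =
      (∑ b : PBond P i, if box b ∧ b.src = x then A' b else 0) + ∑ b : PBond P i, if box b ∧ b.tgt = x then B' b else 0 := by
    rw [Matrix.conjTranspose_add, Matrix.conjTranspose_sum, Matrix.conjTranspose_sum]
    congr 1
    · exact Finset.sum_congr rfl fun b _ => by split_ifs <;> simp [hAH]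
    · exact Finset.sum_congr rfl fun b _ => by split_ifs <;> simp [hBH]
  rw [hexp] at hsym
  -- regroup: `Σ_out (A − A') = Σ_in (B' − B)`
  have hsplit : ∀ (c : PBond P i → Prop) [DecidablePred c] (f g : PBond P i → Matrix (Fin 2) (Fin 2) ℂ),
      (∑ b : PBond P i, if c b then f b - g b else 0) = (∑ b : PBond P i, if c b then f b else 0) - ∑ b : PBond P i, if c b then g b else 0 := by
    intro c _ f g
    rw [← Finset.sum_sub_distrib]
    exact Finset.sum_congr rfl fun b _ => by split_ifs <;> simp
  show (∑ b : PBond P i, if box b ∧ b.src = x then A b - A' b else 0) = ∑ b : PBond P i, if box b ∧ b.tgt = x then B' b - B b else 0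
  rw [hsplit, hsplit, sub_eq_sub_iff_add_eq_add, add_comm (∑ b : PBond P i, if box b ∧ b.tgt = x then B' b else 0)]
  exact hsym.symm


/-! ## §4 Linearised Coulomb with cubic defect at level `i` -/

/-- ★★ **THE LINEARISED COULOMB CONDITION WITH CUBIC DEFECT AT LEVEL `i`** (twin of ✓`norm_covDiv_le_of_orbitMin`).  At a box-`ℓ²`-orbit-minimising pair `(U, U')` (`∀ k, Σ_box dist1(U_bU'_b⁻¹)² ≤
Σ_box dist1(U_b((U'^k)_b)⁻¹)²`), if the perturbation is written `U'_bU_b⁻¹ = exp Y_b` with `‖Y_b‖ ≤ 1` on the box bonds at `x`, then the covariant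
lattice divergence of `Y` at `x` is third-order small:
`‖Σ_{b∈box,b₋=x} Y_b − Σ_{b∈box,b₊=x} U_b⁻¹Y_bU_b‖ ≤ Σ_{b∈box,b₋=x} ‖Y_b‖³ + Σ_{b∈box,b₊=x} ‖Y_b‖³`
(✓`kirchhoff_of_orbitMin` read through `e^Y − e^{−Y} = 2Y + O(‖Y‖³)`). [cite: Balaban1985Averaging, (156)–(163) p.42 (the regime this opens)] -/
theorem norm_covDiv_le_of_orbitMin_level (box : PBond P i → Prop) [DecidablePred box]
    (U U' : GaugeField P i (Matrix.specialUnitaryGroup (Fin 2) ℂ))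
    (hmin : ∀ k : GaugeTransf P i (Matrix.specialUnitaryGroup (Fin 2) ℂ),
      (∑ b : PBond P i, if box b then dist1 (U b * (U' b)⁻¹) ^ 2 else 0) ≤
        ∑ b : PBond P i, if box b then dist1 (U b * (GaugeField.gaugeAct k U' b)⁻¹) ^ 2 else 0)
    (x : Site P i) (Y : PBond P i → Matrix (Fin 2) (Fin 2) ℂ)
    (hW : ∀ b : PBond P i, box b → (b.src = x ∨ b.tgt = x) →
      ((U' b : Matrix.specialUnitaryGroup (Fin 2) ℂ) : Matrix (Fin 2) (Fin 2) ℂ) * (((U b)⁻¹ : Matrix.specialUnitaryGroup (Fin 2) ℂ) : Matrix (Fin 2) (Fin 2) ℂ) = exp (Y b))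
    (hY : ∀ b : PBond P i, box b → (b.src = x ∨ b.tgt = x) → ‖Y b‖ ≤ 1) :
    ‖(∑ b : PBond P i, if box b ∧ b.src = x then Y b else 0) -
        ∑ b : PBond P i, if box b ∧ b.tgt = x then
          (((U b)⁻¹ : Matrix.specialUnitaryGroup (Fin 2) ℂ) : Matrix (Fin 2) (Fin 2) ℂ) * Y b * ((U b : Matrix.specialUnitaryGroup (Fin 2) ℂ) : Matrix (Fin 2) (Fin 2) ℂ) else 0‖ ≤
      (∑ b : PBond P i, if box b ∧ b.src = x then ‖Y b‖ ^ 3 else 0) + ∑ b : PBond P i, if box b ∧ b.tgt = x then ‖Y b‖ ^ 3 else 0 := by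
  letI : NormedAlgebra ℚ (Matrix (Fin 2) (Fin 2) ℂ) := NormedAlgebra.restrictScalars ℚ ℂ _
  -- abbreviations
  set Uc : PBond P i → Matrix (Fin 2) (Fin 2) ℂ := fun b => ((U b : Matrix.specialUnitaryGroup (Fin 2) ℂ) : Matrix (Fin 2) (Fin 2) ℂ) with hUc
  set Ui : PBond P i → Matrix (Fin 2) (Fin 2) ℂ := fun b => (((U b)⁻¹ : Matrix.specialUnitaryGroup (Fin 2) ℂ) : Matrix (Fin 2) (Fin 2) ℂ) with hUi
  set R : PBond P i → Matrix (Fin 2) (Fin 2) ℂ := fun b => (exp (Y b) - exp (-(Y b))) - (2 : ℂ) • Y b with hR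
  -- `exp(−Y_b) = U_b U'_b⁻¹` on the bonds at `x`
  have hWinv : ∀ b : PBond P i, box b → (b.src = x ∨ b.tgt = x) →
      ((U b : Matrix.specialUnitaryGroup (Fin 2) ℂ) : Matrix (Fin 2) (Fin 2) ℂ) * (((U' b)⁻¹ : Matrix.specialUnitaryGroup (Fin 2) ℂ) : Matrix (Fin 2) (Fin 2) ℂ) = exp (-(Y b)) := by
    intro b hb hx
    have h1 : exp (-(Y b)) * exp (Y b) = 1 := by
      rw [← exp_add_of_commute (Commute.refl (Y b)).neg_left, neg_add_cancel, exp_zero]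
    have h2 : exp (Y b) * (((U b : Matrix.specialUnitaryGroup (Fin 2) ℂ) : Matrix (Fin 2) (Fin 2) ℂ) * (((U' b)⁻¹ : Matrix.specialUnitaryGroup (Fin 2) ℂ) : Matrix (Fin 2) (Fin 2) ℂ)) = 1 := by
      rw [← hW b hb hx, ← Submonoid.coe_mul, ← Submonoid.coe_mul, ← Submonoid.coe_mul]
      rw [show U' b * (U b)⁻¹ * (U b * (U' b)⁻¹) = 1 by group]
      rfl
    calc ((U b : Matrix.specialUnitaryGroup (Fin 2) ℂ) : Matrix (Fin 2) (Fin 2) ℂ) * (((U' b)⁻¹ : Matrix.specialUnitaryGroup (Fin 2) ℂ) : Matrix (Fin 2) (Fin 2) ℂ)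
        = (exp (-(Y b)) * exp (Y b)) * (((U b : Matrix.specialUnitaryGroup (Fin 2) ℂ) : Matrix (Fin 2) (Fin 2) ℂ) * (((U' b)⁻¹ : Matrix.specialUnitaryGroup (Fin 2) ℂ) : Matrix (Fin 2) (Fin 2) ℂ)) := by
          rw [h1, one_mul]
      _ = exp (-(Y b)) := by rw [mul_assoc, h2, mul_one]
  -- Kirchhoff, read in the exponential letters: `Σ_out (2Y + R) = Σ_in U⁻¹(2Y + R)U`
  have hK := kirchhoff_of_orbitMin_level box U U' hmin x
  have hout : (∑ b : PBond P i, if box b ∧ b.src = x then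
        ((((U' b : Matrix.specialUnitaryGroup (Fin 2) ℂ) : Matrix (Fin 2) (Fin 2) ℂ) * (((U b)⁻¹ : Matrix.specialUnitaryGroup (Fin 2) ℂ) : Matrix (Fin 2) (Fin 2) ℂ)) -
          (((U b : Matrix.specialUnitaryGroup (Fin 2) ℂ) : Matrix (Fin 2) (Fin 2) ℂ) * (((U' b)⁻¹ : Matrix.specialUnitaryGroup (Fin 2) ℂ) : Matrix (Fin 2) (Fin 2) ℂ))) else 0) =
      ∑ b : PBond P i, if box b ∧ b.src = x then ((2 : ℂ) • Y b + R b) else 0 := by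
    refine Finset.sum_congr rfl fun b _ => ?_
    by_cases h : box b ∧ b.src = x
    · rw [if_pos h, if_pos h, hW b h.1 (Or.inl h.2), hWinv b h.1 (Or.inl h.2), hR]
      exact (add_sub_cancel _ _).symm
    · rw [if_neg h, if_neg h]
  have hin : (∑ b : PBond P i, if box b ∧ b.tgt = x then
        ((((U b)⁻¹ : Matrix.specialUnitaryGroup (Fin 2) ℂ) : Matrix (Fin 2) (Fin 2) ℂ) * ((U' b : Matrix.specialUnitaryGroup (Fin 2) ℂ) : Matrix (Fin 2) (Fin 2) ℂ) -
          ((((U' b)⁻¹ : Matrix.specialUnitaryGroup (Fin 2) ℂ) : Matrix (Fin 2) (Fin 2) ℂ) * ((U b : Matrix.specialUnitaryGroup (Fin 2) ℂ) : Matrix (Fin 2) (Fin 2) ℂ))) else 0) =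
      ∑ b : PBond P i, if box b ∧ b.tgt = x then Ui b * ((2 : ℂ) • Y b + R b) * Uc b else 0 := by
    refine Finset.sum_congr rfl fun b _ => ?_
    by_cases h : box b ∧ b.tgt = x
    · rw [if_pos h, if_pos h]
      -- `U⁻¹U' = U⁻¹ (U'U⁻¹) U` and `U'⁻¹U = U⁻¹ (U U'⁻¹) U`
      have e1 : ((((U b)⁻¹ : Matrix.specialUnitaryGroup (Fin 2) ℂ) : Matrix (Fin 2) (Fin 2) ℂ) * ((U' b : Matrix.specialUnitaryGroup (Fin 2) ℂ) : Matrix (Fin 2) (Fin 2) ℂ)) =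
          Ui b * (((U' b : Matrix.specialUnitaryGroup (Fin 2) ℂ) : Matrix (Fin 2) (Fin 2) ℂ) * (((U b)⁻¹ : Matrix.specialUnitaryGroup (Fin 2) ℂ) : Matrix (Fin 2) (Fin 2) ℂ)) * Uc b := by
        rw [hUi, hUc, ← Submonoid.coe_mul, ← Submonoid.coe_mul, ← Submonoid.coe_mul, ← Submonoid.coe_mul]
        congr 1
        group
      have e2 : ((((U' b)⁻¹ : Matrix.specialUnitaryGroup (Fin 2) ℂ) : Matrix (Fin 2) (Fin 2) ℂ) * ((U b : Matrix.specialUnitaryGroup (Fin 2) ℂ) : Matrix (Fin 2) (Fin 2) ℂ)) =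
          Ui b * (((U b : Matrix.specialUnitaryGroup (Fin 2) ℂ) : Matrix (Fin 2) (Fin 2) ℂ) * (((U' b)⁻¹ : Matrix.specialUnitaryGroup (Fin 2) ℂ) : Matrix (Fin 2) (Fin 2) ℂ)) * Uc b := by
        rw [hUi, hUc, ← Submonoid.coe_mul, ← Submonoid.coe_mul, ← Submonoid.coe_mul, ← Submonoid.coe_mul]
        congr 1
        group
      rw [e1, e2, hW b h.1 (Or.inr h.2), hWinv b h.1 (Or.inr h.2), hR]
      simp only [add_sub_cancel]
      rw [mul_sub, sub_mul]
    · rw [if_neg h, if_neg h]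
  rw [hout, hin] at hK
  -- split the sums: `2·(Σ_out Y − Σ_in U⁻¹YU) = −Σ_out R + Σ_in U⁻¹RU`
  have hsplit_out : (∑ b : PBond P i, if box b ∧ b.src = x then ((2 : ℂ) • Y b + R b) else 0) =
      (2 : ℂ) • (∑ b : PBond P i, if box b ∧ b.src = x then Y b else 0) + ∑ b : PBond P i, if box b ∧ b.src = x then R b else 0 := by
    rw [Finset.smul_sum, ← Finset.sum_add_distrib]
    exact Finset.sum_congr rfl fun b _ => by split_ifs <;> simp
  have hsplit_in : (∑ b : PBond P i, if box b ∧ b.tgt = x then Ui b * ((2 : ℂ) • Y b + R b) * Uc b else 0) =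
      (2 : ℂ) • (∑ b : PBond P i, if box b ∧ b.tgt = x then Ui b * Y b * Uc b else 0) + ∑ b : PBond P i, if box b ∧ b.tgt = x then Ui b * R b * Uc b else 0 := by
    rw [Finset.smul_sum, ← Finset.sum_add_distrib]
    exact Finset.sum_congr rfl fun b _ => by
      split_ifs
      · rw [mul_add, add_mul, Matrix.mul_smul, Matrix.smul_mul]
      · simp
  rw [hsplit_out, hsplit_in] at hK
  have hdiff : (2 : ℂ) • ((∑ b : PBond P i, if box b ∧ b.src = x then Y b else 0) - ∑ b : PBond P i, if box b ∧ b.tgt = x then Ui b * Y b * Uc b else 0) =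
      (∑ b : PBond P i, if box b ∧ b.tgt = x then Ui b * R b * Uc b else 0) - ∑ b : PBond P i, if box b ∧ b.src = x then R b else 0 := by
    -- `2A + C = 2B + D` ⇒ `2A − 2B = D − C`
    rw [smul_sub, sub_eq_sub_iff_add_eq_add, hK, add_comm]
  -- norms
  have h2 : ‖(2 : ℂ) • ((∑ b : PBond P i, if box b ∧ b.src = x then Y b else 0) - ∑ b : PBond P i, if box b ∧ b.tgt = x then Ui b * Y b * Uc b else 0)‖ =
      2 * ‖(∑ b : PBond P i, if box b ∧ b.src = x then Y b else 0) - ∑ b : PBond P i, if box b ∧ b.tgt = x then Ui b * Y b * Uc b else 0‖ := by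
    rw [norm_smul]
    norm_num
  have hRb : ∀ b : PBond P i, box b → (b.src = x ∨ b.tgt = x) → ‖R b‖ ≤ 2 * ‖Y b‖ ^ 3 := fun b hb hx =>
    norm_exp_sub_exp_neg_sub_two_smul_le (Y b) (hY b hb hx)
  have hsumR_out : ‖∑ b : PBond P i, if box b ∧ b.src = x then R b else 0‖ ≤ ∑ b : PBond P i, if box b ∧ b.src = x then 2 * ‖Y b‖ ^ 3 else 0 := by
    refine (norm_sum_le _ _).trans (Finset.sum_le_sum fun b _ => ?_)
    by_cases h : box b ∧ b.src = x
    · rw [if_pos h, if_pos h]; exact hRb b h.1 (Or.inl h.2)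
    · rw [if_neg h, if_neg h, norm_zero]
  have hsumR_in : ‖∑ b : PBond P i, if box b ∧ b.tgt = x then Ui b * R b * Uc b else 0‖ ≤ ∑ b : PBond P i, if box b ∧ b.tgt = x then 2 * ‖Y b‖ ^ 3 else 0 := by
    refine (norm_sum_le _ _).trans (Finset.sum_le_sum fun b _ => ?_)
    by_cases h : box b ∧ b.tgt = x
    · rw [if_pos h, if_pos h]
      exact (norm_conj_le (U b) (R b)).trans (hRb b h.1 (Or.inr h.2))
    · rw [if_neg h, if_neg h, norm_zero]
  have hfin : 2 * ‖(∑ b : PBond P i, if box b ∧ b.src = x then Y b else 0) - ∑ b : PBond P i, if box b ∧ b.tgt = x then Ui b * Y b * Uc b else 0‖ ≤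
      (∑ b : PBond P i, if box b ∧ b.tgt = x then 2 * ‖Y b‖ ^ 3 else 0) + ∑ b : PBond P i, if box b ∧ b.src = x then 2 * ‖Y b‖ ^ 3 else 0 := by
    rw [← h2, hdiff]
    exact (norm_sub_le _ _).trans (add_le_add hsumR_in hsumR_out)
  have e_out : (∑ b : PBond P i, if box b ∧ b.src = x then 2 * ‖Y b‖ ^ 3 else 0) = 2 * ∑ b : PBond P i, if box b ∧ b.src = x then ‖Y b‖ ^ 3 else 0 := by
    rw [Finset.mul_sum]; exact Finset.sum_congr rfl fun b _ => by split_ifs <;> simp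
  have e_in : (∑ b : PBond P i, if box b ∧ b.tgt = x then 2 * ‖Y b‖ ^ 3 else 0) = 2 * ∑ b : PBond P i, if box b ∧ b.tgt = x then ‖Y b‖ ^ 3 else 0 := by
    rw [Finset.mul_sum]; exact Finset.sum_congr rfl fun b _ => by split_ifs <;> simp
  rw [e_out, e_in] at hfin
  have : ‖(∑ b : PBond P i, if box b ∧ b.src = x then Y b else 0) - ∑ b : PBond P i, if box b ∧ b.tgt = x then Ui b * Y b * Uc b else 0‖ ≤
      (∑ b : PBond P i, if box b ∧ b.src = x then ‖Y b‖ ^ 3 else 0) + ∑ b : PBond P i, if box b ∧ b.tgt = x then ‖Y b‖ ^ 3 else 0 := by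
    linarith
  simpa only [hUi, hUc] using this


end Summit.QuantumFields.YangMills.Theorems.PoincareLipschitzOrbitMinLevelCoulomb
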